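import Summits.ValiantsHypothesis.ValiantsHypothesis.Theorems.LacunarySymmetroidMatrixDescartesFlagAsymptotics
import Summits.ValiantsHypothesis.ValiantsHypothesis.Theorems.LacunarySymmetroidMatrixDescartesCensusMirror
import Literature.Analysis.ValidatedNumerics.InertiaSpectrumSlicing
import Literature.LinearAlgebra.MatrixPolynomials.CameronPsarrakos2019.Witness

/-!
# `MatrixDescartes` census — GRAFT LAW toolkit: sign carriers, the flag lemma with a named ON set, eigenframe congruence

HONEST FRAMING.  Object-search cell `pub-symmetroid`, crux `Theses.LacunarySymmetroid.MatrixDescartes`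
(stmt-ValiantsHypothesis-18050); seat val-sym-mdr-p1 (g3).  A pure lemma file (no definitions, no claim about the crux or about
`VP ≠ VNP`) serving the GRAFT LAW for all formats (companion `…GraftLaw.lean`: from any alternation certificate of a real symmetric
`K`-term `m × m` lacunary pencil, one more letter buys `m` more alternations).  Contents: eventual-sign transfer from a nonzero limit
(`eventually_mul_pos_of_tendsto`), sign-carrier algebra, the tree's FLAG LEMMA (`Census.Flag.eventually_det_mul_pos`, seat g2) with the
ON set NAMED by a finset (`eventually_det_mul_pos_on`), the dying-letter limit `det (M + diagonal (σ_a r_a^D)) → det M` for ratios in `[0,1)`,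
orthogonal congruence bookkeeping and the REAL ORTHOGONAL EIGENFRAME of a symmetric matrix (`exists_orth_frame`, from Literature
`InertiaSpectrumSlicing`, Golub–Van Loan Thm 8.1.1), continuity of minors of an evaluated pencil, the value of a grafted pencil
(`graft_eval`), the parity identity `(∏_{b<a} (−λ_b)) ∏_{b≥a} λ_b = (−1)^a ∏ λ`, and the passage from an alternation certificate to a
refuted census row (`not_posRootLawAt_of_alternating`, Literature `le_card_posRoots_of_alternating`).  [folklore] throughout.
-/

-- `Summit.ValiantsHypothesis.ValiantsHypothesis.…` repeats a component by the D-0017 layout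
-- (single-conjunct summit), which the `dupNamespace` linter flags; the name is mandated.
set_option linter.dupNamespace false

namespace Summit.ValiantsHypothesis.ValiantsHypothesis.Theorems.LacunarySymmetroidMatrixDescartes.Census.Graft

open Matrix Finset Filter Topology
open scoped BigOperators

/-! ### Small analytic helpers -/

/-- If `g → L ≠ 0` along a filter then eventually `0 < g · L` (the limit carries the sign). [folklore] -/
theorem eventually_mul_pos_of_tendsto {α : Type*} {l : Filter α} {g : α → ℝ} {L : ℝ}
    (h : Tendsto g l (𝓝 L)) (hL : L ≠ 0) : ∀ᶠ x in l, 0 < g x * L := by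
  have hopen : IsOpen {y : ℝ | 0 < y * L} := isOpen_lt continuous_const (continuous_id.mul continuous_const)
  exact h.eventually (hopen.mem_nhds (mul_self_pos.mpr hL))

/-- Sign transfer: if `u, v` carry the signs of `x, y` and `u · v < 0` then `x · y < 0`. [folklore] -/
theorem mul_neg_of_carriers {x y u v : ℝ} (h1 : 0 < x * u) (h2 : 0 < y * v) (h3 : u * v < 0) :
    x * y < 0 := by
  have h : 0 < (x * y) * (u * v) := by nlinarith [mul_pos h1 h2]
  by_contra hxy
  have hxy' : 0 ≤ x * y := not_lt.mp hxy
  nlinarith [mul_nonneg hxy' (le_of_lt (neg_pos.mpr h3))]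

/-! ### The flag lemma with a named ON set, and the dying-letter limit -/

section Flag

variable {ι : Type*} [Fintype ι] [DecidableEq ι]

/-- **Flag asymptotics, named ON set** (tree `Census.Flag.eventually_det_mul_pos`, seat g2): if `ON = {a : 1 < r_a}` and the
`ONᶜ`-minor of `M` is nonzero, then for all large `D` the determinant `det (M + diagonal (σ_a r_a^D))` has the sign of
`(∏_{ON} σ_a) · det (M | ONᶜ)`. [folklore] -/
theorem eventually_det_mul_pos_on (M : Matrix ι ι ℝ) (σ r : ι → ℝ) (ON : Finset ι)
    (hON : ∀ b, b ∈ ON ↔ 1 < r b) (hσ : ∀ a, σ a ≠ 0) (hr : ∀ a, 0 < r a) (hr1 : ∀ a, r a ≠ 1)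
    (hL : (M.submatrix ((↑) : ↥(ONᶜ) → ι) ((↑) : ↥(ONᶜ) → ι)).det ≠ 0) :
    ∀ᶠ D : ℕ in atTop, 0 < (M + diagonal (fun a => σ a * r a ^ D)).det *
        ((∏ a ∈ ON, σ a) * (M.submatrix ((↑) : ↥(ONᶜ) → ι) ((↑) : ↥(ONᶜ) → ι)).det) := by
  obtain rfl : ON = univ.filter (fun a => 1 < r a) := by
    ext b
    simp [hON b]
  exact Flag.eventually_det_mul_pos M σ r hσ hr hr1 hL

/-- **Dying letter**: if every ratio lies in `[0,1)`, then `det (M + diagonal (σ_a r_a^D)) → det M` as `D → ∞`. [folklore] -/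
theorem tendsto_det_add_diagonal_of_lt_one (M : Matrix ι ι ℝ) (σ r : ι → ℝ)
    (hr0 : ∀ a, 0 ≤ r a) (hr1 : ∀ a, r a < 1) :
    Tendsto (fun D : ℕ => (M + diagonal (fun a => σ a * r a ^ D)).det) atTop (𝓝 M.det) := by
  have h0 : Tendsto (fun D : ℕ => (fun a => σ a * r a ^ D)) atTop (𝓝 (0 : ι → ℝ)) := by
    rw [tendsto_pi_nhds]
    intro a
    have := (tendsto_pow_atTop_nhds_zero_of_lt_one (hr0 a) (hr1 a)).const_mul (σ a)
    simpa using this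
  have hc : Continuous (fun v : ι → ℝ => diagonal v) := continuous_id.matrix_diagonal
  have hdiag : Tendsto (fun D : ℕ => diagonal (fun a => σ a * r a ^ D)) atTop (𝓝 (0 : Matrix ι ι ℝ)) := by
    have h00 : diagonal (0 : ι → ℝ) = (0 : Matrix ι ι ℝ) := diagonal_zero
    have := (hc.tendsto 0).comp h0
    rw [h00] at this
    exact this
  have hsum : Tendsto (fun D : ℕ => M + diagonal (fun a => σ a * r a ^ D)) atTop (𝓝 (M + 0)) :=
    tendsto_const_nhds.add hdiag
  rw [add_zero] at hsum
  have hdet : Continuous (fun A : Matrix ι ι ℝ => A.det) := continuous_id.matrix_det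
  exact (hdet.tendsto M).comp hsum

end Flag

/-! ### Congruence helpers -/

section Congruence

variable {n : Type*} [Fintype n] [DecidableEq n]

/-- `det (Uᵀ A U) = det A` for `U Uᵀ = 1`. [folklore] -/
theorem det_transpose_mul_mul (U : Matrix n n ℝ) (hU : U * Uᵀ = 1) (A : Matrix n n ℝ) :
    (Uᵀ * A * U).det = A.det := by
  rw [det_mul, det_mul, det_transpose]
  have h : U.det * U.det = 1 := by
    have := congrArg Matrix.det hU
    rwa [det_mul, det_transpose, det_one] at this
  calc U.det * A.det * U.det = A.det * (U.det * U.det) := by ring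
    _ = A.det := by rw [h, mul_one]

omit [DecidableEq n] in
/-- Congruence passes through a linear combination of letters. [folklore] -/
theorem transpose_mul_sum_smul_mul (U : Matrix n n ℝ) {K : ℕ} (c : Fin K → ℝ) (S : Fin K → Matrix n n ℝ) :
    Uᵀ * (∑ l, c l • S l) * U = ∑ l, c l • (Uᵀ * S l * U) := by
  rw [Finset.mul_sum, Finset.sum_mul]
  refine Finset.sum_congr rfl fun l _ => ?_
  rw [Matrix.mul_smul, Matrix.smul_mul]

omit [DecidableEq n] in
/-- Congruence preserves symmetry. [folklore] -/
theorem isSymm_transpose_mul_mul (U : Matrix n n ℝ) {A : Matrix n n ℝ} (hA : A.IsSymm) :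
    (Uᵀ * A * U).IsSymm := by
  unfold Matrix.IsSymm at hA ⊢
  rw [transpose_mul, transpose_mul, transpose_transpose, hA, Matrix.mul_assoc]

omit [Fintype n] [DecidableEq n] in
/-- A linear combination of symmetric letters is symmetric. [folklore] -/
theorem isSymm_sum_smul {K : ℕ} (c : Fin K → ℝ) (S : Fin K → Matrix n n ℝ) (hS : ∀ l, (S l).IsSymm) :
    (∑ l, c l • S l).IsSymm := by
  unfold Matrix.IsSymm
  rw [Matrix.transpose_sum]
  exact Finset.sum_congr rfl fun l _ => by rw [Matrix.transpose_smul, (hS l).eq]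

/-- **Real orthogonal eigenframe** of a real symmetric matrix (spectral theorem; Literature `InertiaSpectrumSlicing`, Golub–Van Loan
Thm 8.1.1): `U Uᵀ = Uᵀ U = 1` and `Uᵀ M U` diagonal. [folklore] -/
theorem exists_orth_frame (M : Matrix n n ℝ) (hM : M.IsSymm) :
    ∃ (U : Matrix n n ℝ) (lam : n → ℝ), U * Uᵀ = 1 ∧ Uᵀ * U = 1 ∧ Uᵀ * M * U = diagonal lam := by
  have hH : M.IsHermitian := Matrix.isHermitian_iff_isSymm.mpr hM
  set U : Matrix n n ℝ := (hH.eigenvectorUnitary : Matrix n n ℝ) with hUdef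
  have hUUt : U * Uᵀ = 1 := Literature.Analysis.ValidatedNumerics.eigenvectorUnitary_mul_transpose hH
  have hUtU : Uᵀ * U = 1 := mul_eq_one_comm.mp hUUt
  have h := Literature.Analysis.ValidatedNumerics.sub_smul_one_eq_eigenvectorUnitary_congruence hH 0
  rw [zero_smul, sub_zero] at h
  refine ⟨U, fun i => hH.eigenvalues i - 0, hUUt, hUtU, ?_⟩
  calc Uᵀ * M * U = Uᵀ * (U * diagonal (fun i => hH.eigenvalues i - 0) * Uᵀ) * U := by rw [← h]
    _ = (Uᵀ * U) * diagonal (fun i => hH.eigenvalues i - 0) * (Uᵀ * U) := by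
        simp only [Matrix.mul_assoc]
    _ = diagonal (fun i => hH.eigenvalues i - 0) := by rw [hUtU, Matrix.one_mul, Matrix.mul_one]

end Congruence

/-! ### Pencil helpers -/

/-- Continuity in `y` of any minor of an evaluated pencil `∑ l, y^(d l) • T l`. [folklore] -/
theorem continuous_det_submatrix_pencil {K n : ℕ} {κ : Type*} [Fintype κ] [DecidableEq κ]
    (d : Fin K → ℕ) (T : Fin K → Matrix (Fin n) (Fin n) ℝ) (f : κ → Fin n) :
    Continuous fun y : ℝ => ((∑ l, y ^ d l • T l).submatrix f f).det := by
  apply Continuous.matrix_det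
  refine continuous_pi fun i => continuous_pi fun j => ?_
  simp only [Matrix.submatrix_apply, Matrix.sum_apply, Matrix.smul_apply, smul_eq_mul]
  exact continuous_finsetSum _ fun l _ => (continuous_pow _).mul continuous_const

/-- Value of the grafted pencil: old letters plus `diagonal (σ_b (y/θ_b)^D)`. [folklore] -/
theorem graft_eval {K m : ℕ} (d : Fin K → ℕ) (T : Fin K → Matrix (Fin m) (Fin m) ℝ) (D : ℕ) (σ θ : Fin m → ℝ) (y : ℝ) :
    ∑ l, y ^ (Fin.snoc d D : Fin (K + 1) → ℕ) l • (Fin.snoc T (diagonal fun b => σ b * (θ b)⁻¹ ^ D) :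
        Fin (K + 1) → Matrix (Fin m) (Fin m) ℝ) l
      = (∑ l, y ^ d l • T l) + diagonal (fun b => σ b * (y / θ b) ^ D) := by
  rw [Fin.sum_univ_castSucc]
  simp only [Fin.snoc_castSucc, Fin.snoc_last]
  congr 1
  rw [← Matrix.diagonal_smul]
  congr 1
  funext b
  simp only [Pi.smul_apply, smul_eq_mul, div_eq_mul_inv, mul_pow]
  ring

/-- `(∏_{b<a} (−λ_b)) · ∏_{b ≥ a} λ_b = (−1)^a · ∏_b λ_b` on `Fin m`, `a ≤ m`. [folklore] -/
theorem prod_neg_filter_lt_mul_prod_compl {m : ℕ} (lam : Fin m → ℝ) (a : ℕ) (ha : a ≤ m) :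
    (∏ b ∈ univ.filter (fun b : Fin m => (b : ℕ) < a), -lam b) *
        ∏ b ∈ (univ.filter (fun b : Fin m => (b : ℕ) < a))ᶜ, lam b = (-1) ^ a * ∏ b, lam b := by
  rw [Finset.prod_neg, Fin.card_filter_val_lt, min_eq_right ha, mul_assoc, Finset.prod_mul_prod_compl]

open Summit.ValiantsHypothesis.ValiantsHypothesis.Theorems.MatrixDescartes.Negative (PosRootLawAt)

/-- **From an alternation certificate to a refuted row**: `N ≥ 1` alternations of `det F` along positive test points give
`¬ PosRootLawAt m K (N − 1)` (Literature `le_card_posRoots_of_alternating` + tree `eval_det_pencil_eq`). [folklore] -/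
theorem not_posRootLawAt_of_alternating {m K N : ℕ} (hN : 1 ≤ N) (d : Fin K → ℕ) (S : Fin K → Matrix (Fin m) (Fin m) ℝ)
    (hS : ∀ l, (S l).IsSymm) (τ : Fin (N + 1) → ℝ) (hτ : StrictMono τ) (hpos : ∀ j, 0 < τ j)
    (halt : ∀ j : Fin N, (∑ l, τ j.castSucc ^ d l • S l).det * (∑ l, τ j.succ ^ d l • S l).det < 0) :
    ¬ PosRootLawAt m K (N - 1) := by
  intro hlaw
  set p := ((∑ l, (Polynomial.X : Polynomial ℝ) ^ d l • (S l).map Polynomial.C).det) with hp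
  have halt' : ∀ j : Fin N, p.eval (τ j.castSucc) * p.eval (τ j.succ) < 0 := by
    intro j
    rw [hp, eval_det_pencil_eq, eval_det_pencil_eq]
    exact halt j
  have hcount :=
    Literature.LinearAlgebra.MatrixPolynomials.CameronPsarrakos2019.le_card_posRoots_of_alternating p N τ hτ hpos halt'
  have hbound := hlaw d S hS
  rw [← hp] at hbound
  omega

/-- Transport of an alternation certificate along an equality of alternation counts (bookkeeping). [folklore] -/
theorem alternating_transport {m K N₁ N₂ : ℕ} (hN : N₁ = N₂)
    (h : ∃ (d : Fin K → ℕ) (S : Fin K → Matrix (Fin m) (Fin m) ℝ) (τ : Fin (N₁ + 1) → ℝ),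
      (∀ l, (S l).IsSymm) ∧ StrictMono τ ∧ (∀ j, 0 < τ j) ∧ (∀ j, (∑ l, τ j ^ d l • S l).det ≠ 0) ∧
      ∀ j : Fin N₁, (∑ l, τ j.castSucc ^ d l • S l).det * (∑ l, τ j.succ ^ d l • S l).det < 0) :
    ∃ (d : Fin K → ℕ) (S : Fin K → Matrix (Fin m) (Fin m) ℝ) (τ : Fin (N₂ + 1) → ℝ),
      (∀ l, (S l).IsSymm) ∧ StrictMono τ ∧ (∀ j, 0 < τ j) ∧ (∀ j, (∑ l, τ j ^ d l • S l).det ≠ 0) ∧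
      ∀ j : Fin N₂, (∑ l, τ j.castSucc ^ d l • S l).det * (∑ l, τ j.succ ^ d l • S l).det < 0 := by
  subst hN
  exact h

/-- Values of alternating sign are nonzero (bookkeeping). [folklore] -/
theorem ne_zero_of_alternating {N : ℕ} (hN : 1 ≤ N) (f : Fin (N + 1) → ℝ)
    (halt : ∀ j : Fin N, f j.castSucc * f j.succ < 0) : ∀ j, f j ≠ 0 := by
  intro j hj
  by_cases h : (j : ℕ) < N
  · have := halt ⟨j, h⟩
    have hc : (Fin.castSucc (⟨j, h⟩ : Fin N) : Fin (N + 1)) = j := Fin.ext rfl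
    rw [hc, hj, zero_mul] at this
    exact lt_irrefl 0 this
  · obtain ⟨N', rfl⟩ : ∃ N', N = N' + 1 := ⟨N - 1, by omega⟩
    have hjl : j = (Fin.last N' : Fin (N' + 1)).succ := by
      ext; simp only [Fin.val_succ, Fin.val_last]; omega
    have := halt (Fin.last N')
    rw [← hjl, hj, mul_zero] at this
    exact lt_irrefl 0 this

end Summit.ValiantsHypothesis.ValiantsHypothesis.Theorems.LacunarySymmetroidMatrixDescartes.Census.Graft
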